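import Mathlib.Algebra.Polynomial.Derivative
import Mathlib.FieldTheory.Perfect
import Mathlib.FieldTheory.Separable
import Mathlib.RingTheory.Polynomial.UniqueFactorization
import Mathlib.RingTheory.UniqueFactorizationDomain.NormalizedFactors
import Mathlib.Algebra.BigOperators.Fin

/-!
# Factorisation bookkeeping in `K[t]` (line LonelyTranslates c1, Prop27Reduction; helpers of `relFactor`)

* `exists_factor_data` — over a field of characteristic `0`, a non-zero polynomial is a unit
  constant times a product of powers of finitely many irreducible (hence separable) polynomials,
  with Bézout identities for each factor;
* `roots_of_evaluated_identities` — the root bookkeeping used after specialising the generic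
  factorisation to a `K`-point.
-/

set_option linter.dupNamespace false

namespace Summit.MatrixMultiplication.MatrixMultiplication.Theorems.PairwiseCurvedTilingsLC.Negative

open Polynomial

variable {K : Type} [Field K]

/-- Root bookkeeping in `K[t]`: from `β^N P = U ∏ Q_i^{m_i}`, `U V = β²` and Bézout identities
`A_i Q_i + A_i' Q_i' = β²` with `β ≠ 0`, every root of `P` is a root of some `Q_i` and all roots
of the `Q_i` are simple. [folklore] -/
theorem roots_of_evaluated_identities {s : ℕ} {β : K} (hβ : β ≠ 0) (N : ℕ) (m : Fin s → ℕ)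
    (Px Ux Vx : K[X]) (Qx Ax Ax' : Fin s → K[X])
    (e₁ : Polynomial.C β ^ N * Px = Ux * ∏ i, Qx i ^ m i) (e₂ : Ux * Vx = Polynomial.C β ^ 2)
    (e₃ : ∀ i, Ax i * Qx i + Ax' i * derivative (Qx i) = Polynomial.C β ^ 2) :
    (∀ t, Px.eval t = 0 → ∃ i, (Qx i).eval t = 0) ∧
      (∀ i t, (Qx i).eval t = 0 → (derivative (Qx i)).eval t ≠ 0) := by
  have hUx : ∀ t, Ux.eval t ≠ 0 := by
    intro t h0
    have := congrArg (Polynomial.eval t) e₂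
    simp only [eval_mul, eval_pow, eval_C, h0, zero_mul] at this
    exact pow_ne_zero 2 hβ this.symm
  refine ⟨fun t ht => ?_, fun i t ht hder => ?_⟩
  · have := congrArg (Polynomial.eval t) e₁
    simp only [eval_mul, eval_pow, eval_C, ht, mul_zero, Polynomial.eval_prod] at this
    have h0 : ∏ i, (Qx i).eval t ^ m i = 0 := (mul_eq_zero.1 this.symm).resolve_left (hUx t)
    obtain ⟨i, -, hi⟩ := Finset.prod_eq_zero_iff.1 h0
    exact ⟨i, pow_eq_zero_iff (by rintro h; simp [h] at hi) |>.1 hi⟩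
  · have := congrArg (Polynomial.eval t) (e₃ i)
    simp only [eval_add, eval_mul, eval_C, eval_pow, ht, hder, mul_zero, add_zero] at this
    exact pow_ne_zero 2 hβ this.symm

/-- Factorisation data of a non-zero polynomial over a field of characteristic `0`: distinct monic
irreducible factors `q_i` with multiplicities `m_i`, a unit leading constant `u₀` (with inverse
`v₀`), and Bézout identities `a_i q_i + a_i' q_i' = 1` (irreducible polynomials are separable).
[folklore] -/
theorem exists_factor_data {T : Type} [Field T] [CharZero T] {p : T[X]} (hp : p ≠ 0) :
    ∃ (s : ℕ) (qv : Fin s → T[X]) (m : Fin s → ℕ) (u₀ v₀ : T) (av av' : Fin s → T[X]),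
      (∀ i, Irreducible (qv i)) ∧ p = Polynomial.C u₀ * ∏ i, qv i ^ m i ∧ u₀ * v₀ = 1 ∧
        ∀ i, av i * qv i + av' i * derivative (qv i) = 1 := by
  classical
  let fs : Finset T[X] := (UniqueFactorizationMonoid.normalizedFactors p).toFinset
  let qv : Fin fs.card → T[X] := fun i => (fs.equivFin.symm i).1
  let m : Fin fs.card → ℕ := fun i => (UniqueFactorizationMonoid.normalizedFactors p).count (qv i)
  have hq_mem : ∀ i, qv i ∈ UniqueFactorizationMonoid.normalizedFactors p := fun i =>
    Multiset.mem_toFinset.1 (fs.equivFin.symm i).2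
  have hq_irr : ∀ i, Irreducible (qv i) := fun i =>
    UniqueFactorizationMonoid.irreducible_of_normalized_factor _ (hq_mem i)
  obtain ⟨u, hu⟩ := UniqueFactorizationMonoid.prod_normalizedFactors hp
  obtain ⟨u₀, hu₀unit, hu₀⟩ := Polynomial.isUnit_iff.1 u.isUnit
  have hprod : (UniqueFactorizationMonoid.normalizedFactors p).prod = ∏ i, qv i ^ m i := by
    rw [Finset.prod_multiset_count, ← Finset.prod_coe_sort]
    exact Fintype.prod_equiv fs.equivFin _ _ (fun q => by simp [qv, m])
  obtain ⟨v₀, hv₀⟩ := hu₀unit.exists_right_inv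
  have hsep : ∀ i, ∃ a a' : T[X], a * qv i + a' * derivative (qv i) = 1 := fun i =>
    (hq_irr i).separable
  choose av av' hav using hsep
  refine ⟨fs.card, qv, m, u₀, v₀, av, av', hq_irr, ?_, hv₀, hav⟩
  rw [← hprod, hu₀, mul_comm]
  exact hu.symm


end Summit.MatrixMultiplication.MatrixMultiplication.Theorems.PairwiseCurvedTilingsLC.Negative
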